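import Summits.AtomisticToContinuum.BoseEinsteinCondensation.Theorems.BECConjugateDominationHardCoreExtensionPositiveOfWeightedLogGradientBound
import HarnessLib

/-!
# Ground states of a hard-core maximal form vanish off the free region (support file of skeleton v12)

Line `third-law-current-floor`, crux `BECConjugateDomination.HardCoreExtension` (stmt-AtomisticToContinuum-11786), lead c3.
For `v = ⊤` on `[0, a)` and a maximal-form ground state `η` at finite `E₀`: `η = 0` a.e. on the complement of the free
region `{t | ∀ i ≠ j, a/L < ρᵢⱼ(t)}` — on the open tubes `{ρᵢⱼ < a/L}` by finiteness of the potential energy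
(`ae_eq_zero_on_tubes_of_maxFormPot_ne_top` at every radius `a' < a`), and the level sets `{ρᵢⱼ = a/L}` are Haar-null
(every coordinate line of particle `i` meets them in countably many parameters).
-/

noncomputable section

namespace Summit.AtomisticToContinuum.BoseEinsteinCondensation.Cruxes.HardCoreExtension.ThirdLawCurrentFloorAlt

open MeasureTheory Filter UnitAddTorus Set
open scoped ENNReal NNReal BigOperators Topology InnerProductSpace ComplexConjugate
open Literature.MathematicalPhysics.QuantumManyBody.BoseGas
open Literature.Analysis.FunctionSpaces

attribute [local instance] Literature.MathematicalPhysics.QuantumManyBody.BoseGas.formDomain_measureSpace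
  Literature.MathematicalPhysics.QuantumManyBody.BoseGas.formDomain_isProbabilityMeasure
  Literature.MathematicalPhysics.QuantumManyBody.BoseGas.formDomain_isProbabilityMeasure_pi

variable {N : ℕ} {L : ℝ} {v : ℝ → ℝ≥0∞}

/-- Along the coordinate line of `(i, 0)`, `ρᵢⱼ² = ‖t(i,0) - t(j,0) + x‖² + ‖t(i,1) - t(j,1)‖² + ‖t(i,2) - t(j,2)‖²`. [folklore] -/
theorem pairDist_sq_add_single_zero {i j : Fin N} (hij : i ≠ j) (t : UnitAddTorus (Fin N × Fin 3)) (x : ℝ) :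
    Torus.pairDist i j (t + Pi.single (i, (0 : Fin 3)) ((x : ℝ) : UnitAddCircle)) ^ 2 =
      ‖t (i, 0) - t (j, 0) + ((x : ℝ) : UnitAddCircle)‖ ^ 2 + ‖t (i, 1) - t (j, 1)‖ ^ 2 + ‖t (i, 2) - t (j, 2)‖ ^ 2 := by
  rw [Torus.pairDist_sq, Fin.sum_univ_three, Torus.pair_coord_add_single hij, Torus.pair_coord_add_single hij,
    Torus.pair_coord_add_single hij]
  simp

/-- The line sections of a level set `{ρᵢⱼ = c}` along the coordinate `(i, 0)` are countable: with a lift `u` of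
`t(i,0) - t(j,0)` and `d = c² - ‖t(i,1) - t(j,1)‖² - ‖t(i,2) - t(j,2)‖²`, every parameter `x` of the section satisfies
`|u + x - round (u + x)| = √d`, so `x ∈ {n - u ± √d : n ∈ ℤ}`. [folklore] -/
theorem countable_lineSection_pairDist_eq {i j : Fin N} (hij : i ≠ j) (t : UnitAddTorus (Fin N × Fin 3)) (c : ℝ) :
    ({x : ℝ | Torus.pairDist i j (t + Pi.single (i, (0 : Fin 3)) ((x : ℝ) : UnitAddCircle)) = c}).Countable := by
  obtain ⟨u, hu⟩ : ∃ u : ℝ, ((u : ℝ) : UnitAddCircle) = t (i, 0) - t (j, 0) := QuotientAddGroup.mk_surjective _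
  set d : ℝ := c ^ 2 - ‖t (i, 1) - t (j, 1)‖ ^ 2 - ‖t (i, 2) - t (j, 2)‖ ^ 2 with hd
  refine (countable_range (fun p : ℤ × Bool => (p.1 : ℝ) - u + (if p.2 then Real.sqrt d else -Real.sqrt d))).mono ?_
  intro x hx
  have hx' : Torus.pairDist i j (t + Pi.single (i, (0 : Fin 3)) ((x : ℝ) : UnitAddCircle)) = c := hx
  have hsq := pairDist_sq_add_single_zero hij t x
  rw [hx'] at hsq
  have hnorm : ‖t (i, 0) - t (j, 0) + ((x : ℝ) : UnitAddCircle)‖ ^ 2 = d := by rw [hd]; linarith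
  rw [← hu, ← QuotientAddGroup.mk_add, UnitAddCircle.norm_eq] at hnorm
  have hd0 : 0 ≤ d := by rw [← hnorm]; positivity
  have habs : |u + x - round (u + x)| = Real.sqrt d := by
    rw [← Real.sqrt_sq (abs_nonneg _), hnorm]
  rcases (abs_eq (Real.sqrt_nonneg d)).1 habs with h | h
  · refine ⟨(round (u + x), true), ?_⟩
    simp only [ite_true]
    linarith
  · refine ⟨(round (u + x), false), ?_⟩
    simp only [Bool.false_eq_true, ite_false]
    linarith

/-- **Level sets of the pair distance are Haar-null**: for `i ≠ j` and every `c`, `|{t | ρᵢⱼ(t) = c}| = 0`. [folklore] -/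
theorem volume_setOf_pairDist_eq_zero {i j : Fin N} (hij : i ≠ j) (c : ℝ) :
    (volume : Measure (UnitAddTorus (Fin N × Fin 3))) {t | Torus.pairDist i j t = c} = 0 :=
  HardLayerAux.volume_eq_zero_of_lineSection_countable (i, 0)
    ((Torus.continuous_pairDist i j).measurable (measurableSet_singleton c))
    fun t => countable_lineSection_pairDist_eq hij t c

/-- **Hard-core ground states vanish off the free region.** If `v = ⊤` on `[0, a)` (`0 < a`), `L > 0`, `E₀(v) < ⊤` and
`η ∈ maxFormGroundStates v N L`, then `η = 0` a.e. on `{t | ∃ i ≠ j, ρᵢⱼ(t) ≤ a/L}`, the complement of the free region.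
[cite: LSSY2005, Ch. 2, paragraph after eq. (2.1)] -/
theorem ae_eq_zero_off_freeRegion (hv : IsRepulsiveFiniteRange v) {a : ℝ} (ha : 0 < a)
    (hcore : ∀ r : ℝ, 0 ≤ r → r < a → v r = ⊤) (hL : 0 < L) (hE : periodicGroundStateEnergy v N L ≠ ⊤)
    {η : Lp ℂ 2 (volume : Measure (UnitAddTorus (Fin N × Fin 3)))} (hη : η ∈ maxFormGroundStates v N L) :
    ∀ᵐ t ∂(volume : Measure (UnitAddTorus (Fin N × Fin 3))),
      t ∉ {t : UnitAddTorus (Fin N × Fin 3) | ∀ i j : Fin N, i ≠ j → a / L < Torus.pairDist i j t} →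
        (η : UnitAddTorus (Fin N × Fin 3) → ℂ) t = 0 := by
  have hP : maxFormPot v L η ≠ ⊤ := maxFormPot_ne_top_of_mem_maxFormGroundStates hE hη
  -- the open tubes, exhausted by the closed tubes of radii `a (1 - 1/(n+2))`
  have htube : ∀ n : ℕ, ∀ᵐ t ∂(volume : Measure (UnitAddTorus (Fin N × Fin 3))),
      (∃ i j : Fin N, i < j ∧ Torus.pairDist i j t ≤ a * (1 - 1 / ((n : ℝ) + 2)) / L) →
        (η : UnitAddTorus (Fin N × Fin 3) → ℂ) t = 0 := by
    intro n
    have h2 : (0 : ℝ) < (n : ℝ) + 2 := by positivity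
    have h1 : a * (1 - 1 / ((n : ℝ) + 2)) < a := by
      have : 0 < a * (1 / ((n : ℝ) + 2)) := by positivity
      nlinarith
    have h := ae_eq_zero_on_tubes_of_maxFormPot_ne_top (N := N) hL hv.1
      (fun r hr hra => hcore r hr (hra.trans_lt h1)) hP
    rw [Torus.volume_eq_pi_haarAddCircle] at h
    exact h
  have hlevel : ∀ᵐ t ∂(volume : Measure (UnitAddTorus (Fin N × Fin 3))), ∀ i j : Fin N, i ≠ j →
      Torus.pairDist i j t ≠ a / L := by
    refine ae_all_iff.2 fun i => ae_all_iff.2 fun j => ?_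
    by_cases hij : i = j
    · exact Eventually.of_forall fun t h => absurd hij h
    · filter_upwards [measure_eq_zero_iff_ae_notMem.1 (volume_setOf_pairDist_eq_zero hij (a / L))] with t ht _
      exact ht
  filter_upwards [ae_all_iff.2 htube, hlevel] with t ht hl hnot
  simp only [not_forall, not_lt, exists_prop] at hnot
  obtain ⟨i, j, hij, hle⟩ := hnot
  have hlt : Torus.pairDist i j t < a / L := lt_of_le_of_ne hle (hl i j hij)
  -- some closed tube of smaller radius already contains `t`
  obtain ⟨n, hn⟩ : ∃ n : ℕ, Torus.pairDist i j t ≤ a * (1 - 1 / ((n : ℝ) + 2)) / L := by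
    have hgap : 0 < a / L - Torus.pairDist i j t := sub_pos.2 hlt
    obtain ⟨n, hn⟩ := exists_nat_gt (a / L / (a / L - Torus.pairDist i j t))
    refine ⟨n, ?_⟩
    have h2 : (0 : ℝ) < (n : ℝ) + 2 := by positivity
    have haL : 0 < a / L := div_pos ha hL
    rw [div_lt_iff₀ hgap] at hn
    rw [le_div_iff₀ hL]
    have key : a / L * (1 / ((n : ℝ) + 2)) ≤ a / L - Torus.pairDist i j t := by
      rw [← div_eq_mul_one_div, div_le_iff₀ h2]
      nlinarith
    have : Torus.pairDist i j t ≤ a / L * (1 - 1 / ((n : ℝ) + 2)) := by nlinarith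
    calc Torus.pairDist i j t * L ≤ a / L * (1 - 1 / ((n : ℝ) + 2)) * L := by nlinarith
      _ = a * (1 - 1 / ((n : ℝ) + 2)) := by field_simp
  rcases lt_or_gt_of_ne hij with h | h
  · exact ht n ⟨i, j, h, hn⟩
  · exact ht n ⟨j, i, h, by rwa [Torus.pairDist_comm]⟩

/-- **Closed form** (registered sub-goal `freeRegionVanishing_c3` of the crux item; restatement of
`ae_eq_zero_off_freeRegion`). [cite: LSSY2005, Ch. 2, paragraph after eq. (2.1)] -/
theorem freeRegionVanishing_c3 :
    ∀ (N : ℕ) (L : ℝ) (v : ℝ → ℝ≥0∞), IsRepulsiveFiniteRange v → ∀ a : ℝ, 0 < a → (∀ r : ℝ, 0 ≤ r → r < a → v r = ⊤) → 0 < L → periodicGroundStateEnergy v N L ≠ ⊤ → ∀ η : Lp ℂ 2 (volume : Measure (UnitAddTorus (Fin N × Fin 3))), η ∈ maxFormGroundStates v N L → ∀ᵐ t ∂(volume : Measure (UnitAddTorus (Fin N × Fin 3))), t ∉ {t : UnitAddTorus (Fin N × Fin 3) | ∀ i j : Fin N, i ≠ j → a / L < Torus.pairDist i j t} → (η : UnitAddTorus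 (Fin N × Fin 3) → ℂ) t = 0 :=
  fun _ _ _ hv _ ha hcore hL hE _ hη => ae_eq_zero_off_freeRegion hv ha hcore hL hE hη

end Summit.AtomisticToContinuum.BoseEinsteinCondensation.Cruxes.HardCoreExtension.ThirdLawCurrentFloorAlt

end
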